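import Summits.BirchSwinnertonDyer.Rank1Residual.Additive.XGordCyclotomicThreeLowerJoint
import Summits.BirchSwinnertonDyer.Rank1Residual.Additive.XGordCyclotomicThreeLowerX3NoMilneFacts
import Summits.BirchSwinnertonDyer.Rank1Residual.Additive.XGordRankZeroCyclotomicThreeLowerOrdFacts
import Summits.BirchSwinnertonDyer.Rank1Residual.Additive.XGordRankZeroOneCyclotomicThreeLowerNoLocalFacts
import HarnessLib

/-!
# The JOINT X3 / X4 LOWER class forms at `p = 3` over `K = ℚ(ζ₃)` (ranks `(0,0)` / `(0,1)`) from named facts + (⊇/K) — Milne's A73 PROVED AWAY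
# (cell `b2b-bsdres`, team n1011, seat p16 GEN 11; lead R5-87 (e) (W2) = additive-p4 GEN 23 word: the
# UPPER / two-sided no-Milne twins of the additive-p4 ℚ(ζ₃) lines are the p16 lineage's; row T-MIL-CAN)

HONEST FRAMING (cell `b2b-bsdres`, run/shared/lean/b2b/bsd-rank1-residual/, verbatim in every
file): the goal of the cell is to DELETE the COMBINATION-SHAPED residual classes of the
Birch–Swinnerton-Dyer formula for ALL analytic-rank `≤ 1` elliptic curves over `ℚ` — "full BSD
formula for every rank `≤ 1` curve in class `C`" assembled STRICTLY from published theorems — so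
that the rank-`≤ 1` remainder becomes exactly the CONSTRUCTION-SHAPED classes, which are TYPED
(missing-input `Prop`s), NOT attempted. This is not "finishing BSD". Team n1011 (N10 / N11), seat p16:
research route; X1 / X3 / X4 / X10 / N10 / N11 labels and marks UNCHANGED; nothing booked. Theorems only.

This file is `XGordCyclotomicThreeLowerJoint.lean` (mathematics, census and references in THAT file's docstrings,
unchanged) with the Milne binder `hMilne : Milne1972.bsdQuotient_baseChange_quadratic_anyModel` (A73)
DELETED from every Milne-binding theorem and NOTHING added: each such theorem is re-issued under its name
with the suffix `_noMilne`, every other binder and every proof line byte-identical, every call to a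
Milne-binding tree theorem redirected to its no-Milne twin (`…_noLocal` cores / `…_noMilne` Facts of the
p16 lineage); Milne-free helpers of the source file are used as landed, not re-declared. What the
additive-p4 cores read from A73 — `Ш(V_K)` finite and the `3`-adic valuation of the card identity over
`K = ℚ(ζ₃)` — are the THEOREMS `shaFinite_baseChange_of_twist` and T-MIL-CAN FILE 4
`padicVal_card_identity_baseChange[_anyRank]_of_natAbs_discr_eq` (`|d_K| = 3`, `V` good or multiplicative
at `3`: the per-place fibre identities (T) at EVERY place — n1011-p01's T-MIL-3 H-5a with rows T-MIL-B2 /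
T-A233 inside). Every other displayed hypothesis (named facts, (⊇/K) where present, census bits,
certificates) is exactly the source file's. Labels UNCHANGED; nothing booked; no mark moves.
-/

noncomputable section

open scoped Classical MatrixGroups ModularForm

open CongruenceSubgroup WeierstrassCurve NumberField IsDedekindDomain
  Literature.NumberTheory.EllipticCurves Literature.NumberTheory.EllipticCurves.ModularForms
  Literature.NumberTheory.EllipticCurves.Rank1Residual
  Literature.NumberTheory.EllipticCurves.Rank1Residual.Typed
  Literature.NumberTheory.GaloisRepresentations

namespace Summit.BirchSwinnertonDyer.Rank1Residual.Additive

section Joint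

variable (V : WeierstrassCurve ℚ) [V.IsElliptic] [V.IsGloballyMinimal]
  (W : WeierstrassCurve ℚ) [W.IsElliptic] [W.IsGloballyMinimal]

/- The ONE residual input (⊇/K) for `V` over `K = CyclotomicField 3 ℚ`; shared section hypothesis. -/
variable
    (hLowK : ∀ {κ : ZpExtension (CyclotomicField 3 ℚ) 3}
      {γ : Field.absoluteGaloisGroup (CyclotomicField 3 ℚ)} {N : ℕ} [NeZero N]
      {f : CuspForm (Gamma0 N) 2},
      κ.IsCyclotomic → κ.IsTopGenerator γ →
      (∃ ζ : ℤ_[3]ˣ, IsOfFinOrder ζ ∧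
        ((GaloisRep.cyclotomicCharacter (CyclotomicField 3 ℚ) 3 γ * ζ : ℤ_[3]ˣ) : ℤ_[3]) =
          (cyclotomicGenerator 3 : ℤ_[3])) →
      IsNewformOf V f →
      ∀ (D : (V.baseChange (CyclotomicField 3 ℚ)).SelmerDualData κ γ) (ϖ ϖ' : ℚ),
        (ϖ : ℝ) * V.realPeriodRat = plusPeriod f →
        (ϖ' : ℝ) * V.imaginaryPeriodRat = minusPeriod f →
        ∀ g ∈ D.charIdeal, ∃ h : IwasawaAlgebra 3,
          iwasawaToPowerSeries 3 g =
            iwasawaToPowerSeries 3 h *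
              (PowerSeries.C ((ϖ : ℚ_[3]) * (ϖ' : ℚ_[3])) *
                (padicLFunction f ((unitRoot V 3 : ℤ_[3]) : ℚ_[3]) *
                  padicLFunctionMinusBranch f ((unitRoot V 3 : ℤ_[3]) : ℚ_[3]) 1)))

include hLowK

/-- **X4, ranks `(0,0)`: `JointLowerBoundAt V W 3`** (the pair currency p252148) for the good ordinary
`V` and its additive twist `W = C • V^{(−3)}` with `surj(3) ∧ ram(3)`, from (⊇/K) + named facts —
`XGordCyclotomicThreeLower.exists_padicVal_shaAn_add_le_of_surj_of_ram_noMilne` repackaged. Anomalous rows included.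
[cite: GreenbergLNM1716, Thm. 4.1 (p. 102)] [cite: Miller2011LMS, Def. 1.1] -/
theorem XGordCyclotomicThreeLower.jointLowerBoundAt_of_surj_of_ram_noMilne
    (hKato : Kato2004.charIdeal_dvd_padicLFunction_cyclotomicThree_of_surjective)
    (hGr : Greenberg1999.thm41_charValue_rankZero_numberField)
    (hGZK : rank_eq_analyticRank_of_analyticRank_le_one) (hmod : hasEntireLFunction_rat)
    (hmodD : nonempty_modularParametrizationData)
    (C : VariableChange ℚ) (hC : C • V.quadraticTwist (-(3 : ℚ)) = W)
    (hord : IsOrdinaryAt V 3) (hsurj : Surj W 3) (hram : Ram W 3)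
    (hadd : Addv W 3) (hrV : V.analyticRank = 0) (hrW : W.analyticRank = 0) :
    JointLowerBoundAt V W 3 :=
  XGordCyclotomicThreeLower.exists_padicVal_shaAn_add_le_of_surj_of_ram_noMilne V W hLowK hKato hGr hGZK hmod hmodD C hC hord hsurj hram hadd hrV hrW

/-- **X4, ranks `(0,0)`: both `MissingPPartAt`s from the joint lower half and BOTH upper halves**
(`missingPPartAt_and_of_joint_of_upper_of_upper`). [cite: Miller2011LMS, Def. 1.1] -/
theorem XGordCyclotomicThreeLower.missingPPartAt_and_of_upper_of_upper_twist_noMilne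
    (hKato : Kato2004.charIdeal_dvd_padicLFunction_cyclotomicThree_of_surjective)
    (hGr : Greenberg1999.thm41_charValue_rankZero_numberField)
    (hGZK : rank_eq_analyticRank_of_analyticRank_le_one) (hmod : hasEntireLFunction_rat)
    (hmodD : nonempty_modularParametrizationData)
    (C : VariableChange ℚ) (hC : C • V.quadraticTwist (-(3 : ℚ)) = W)
    (hord : IsOrdinaryAt V 3) (hsurj : Surj W 3) (hram : Ram W 3)
    (hadd : Addv W 3) (hrV : V.analyticRank = 0) (hrW : W.analyticRank = 0)
    (huV : MissingUpperBoundAt V 3) (huW : MissingUpperBoundAt W 3) :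
    MissingPPartAt V 3 ∧ MissingPPartAt W 3 :=
  missingPPartAt_and_of_joint_of_upper_of_upper
    (XGordCyclotomicThreeLower.jointLowerBoundAt_of_surj_of_ram_noMilne V W hLowK hKato hGr hGZK hmod hmodD C hC hord hsurj hram hadd hrV hrW) huV huW

/-- **X4, ranks `(0,1)` (twist of analytic rank ONE, certificate `[T¹]L₃ ≠ 0`): `JointLowerBoundAt V W 3`**
— `XGordRankZeroOneCyclotomicThreeLower.exists_padicVal_shaAn_add_le_of_surj_of_ram_noMilne` repackaged.
[cite: GreenbergLNM1716, §4 p. 110] [cite: Miller2011LMS, Def. 1.1] -/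
theorem XGordRankZeroOneCyclotomicThreeLower.jointLowerBoundAt_of_surj_of_ram_noMilne
    (hKato : Kato2004.charIdeal_dvd_padicLFunction_cyclotomicThree_of_surjective)
    (hS1 : Greenberg1999.schneider_charCoeff_rankOne_quadraticBaseChange)
    (hPR : perrinRiou_rankOne_leadingTerms_odd) (hMT : mazur_tate_sigma_exists_odd)
    (hGZK : rank_eq_analyticRank_of_analyticRank_le_one) (hmod : hasEntireLFunction_rat)
    (hmodD : nonempty_modularParametrizationData)
    (C : VariableChange ℚ) (hC : C • V.quadraticTwist (-(3 : ℚ)) = W)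
    (hord : IsOrdinaryAt V 3) (hsurj : Surj W 3) (hram : Ram W 3) (hadd : Addv W 3)
    (hrV : V.analyticRank = 1) (hrW : W.analyticRank = 0)
    (hcert : ∀ {N : ℕ} [NeZero N] (f : CuspForm (Gamma0 N) 2), IsNewformOf V f →
      PowerSeries.coeff 1 (padicLFunction f ((unitRoot V 3 : ℤ_[3]) : ℚ_[3])) ≠ 0) :
    JointLowerBoundAt V W 3 :=
  XGordRankZeroOneCyclotomicThreeLower.exists_padicVal_shaAn_add_le_of_surj_of_ram_noMilne V W hLowK hKato hS1 hPR hMT hGZK hmod hmodD C hC hord hsurj hram hadd hrV hrW hcert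

/-- **X3, ranks `(0,0)` (reducible `V[3]`, Wuthrich torsion): `JointLowerBoundAt V W 3`** —
`X3CyclotomicThreeLower.exists_padicVal_shaAn_add_le_of_facts_noMilne` repackaged.
[cite: Wuthrich2014, Thm. 16 (p. 397)] [cite: Miller2011LMS, Def. 1.1] -/
theorem X3CyclotomicThreeLower.jointLowerBoundAt_of_facts_noMilne
    (hW16 : Wuthrich2014.charIdeal_dvd_padicLFunction_cyclotomicThree)
    (hGr : Greenberg1999.thm41_charValue_rankZero_numberField)
    (hGZK : rank_eq_analyticRank_of_analyticRank_le_one) (hmod : hasEntireLFunction_rat)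
    (hmodD : nonempty_modularParametrizationData)
    (C : VariableChange ℚ) (hC : C • V.quadraticTwist (-(3 : ℚ)) = W)
    (hord : IsOrdinaryAt V 3) (hred : ¬ V.HasIrreducibleModPGaloisRep 3) (hadd : Addv W 3)
    (hrV : V.analyticRank = 0) (hrW : W.analyticRank = 0) :
    JointLowerBoundAt V W 3 :=
  X3CyclotomicThreeLower.exists_padicVal_shaAn_add_le_of_facts_noMilne V W hLowK hW16 hGr hGZK hmod hmodD C hC hord hred hadd hrV hrW

/-- **X3, ranks `(0,1)`: `JointLowerBoundAt V W 3`** —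
`X3GordRankZeroOneCyclotomicThreeLower.exists_padicVal_shaAn_add_le_of_facts_noMilne` repackaged.
[cite: Wuthrich2014, Thm. 16 (p. 397)] [cite: Miller2011LMS, Def. 1.1] -/
theorem X3GordRankZeroOneCyclotomicThreeLower.jointLowerBoundAt_of_facts_noMilne
    (hW16 : Wuthrich2014.charIdeal_dvd_padicLFunction_cyclotomicThree)
    (hS1 : Greenberg1999.schneider_charCoeff_rankOne_quadraticBaseChange)
    (hPR : perrinRiou_rankOne_leadingTerms_odd) (hMT : mazur_tate_sigma_exists_odd)
    (hGZK : rank_eq_analyticRank_of_analyticRank_le_one) (hmod : hasEntireLFunction_rat)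
    (hmodD : nonempty_modularParametrizationData)
    (C : VariableChange ℚ) (hC : C • V.quadraticTwist (-(3 : ℚ)) = W)
    (hord : IsOrdinaryAt V 3) (hred : ¬ V.HasIrreducibleModPGaloisRep 3) (hadd : Addv W 3)
    (hrV : V.analyticRank = 1) (hrW : W.analyticRank = 0)
    (hcert : ∀ {N : ℕ} [NeZero N] (f : CuspForm (Gamma0 N) 2), IsNewformOf V f →
      PowerSeries.coeff 1 (padicLFunction f ((unitRoot V 3 : ℤ_[3]) : ℚ_[3])) ≠ 0) :
    JointLowerBoundAt V W 3 :=
  X3GordRankZeroOneCyclotomicThreeLower.exists_padicVal_shaAn_add_le_of_facts_noMilne V W hLowK hW16 hS1 hPR hMT hGZK hmod hmodD C hC hord hred hadd hrV hrW hcert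

end Joint

end Summit.BirchSwinnertonDyer.Rank1Residual.Additive

end
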